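import Literature.NumberTheory.LFunctions.KowalskiMichelPeterssonFormula
import HarnessLib

/-!
# The weight-2 Poincaré series of `Γ₀(N)` with Hecke's convergence factor (definitions)

Topic `Literature/NumberTheory/ModularForms` (namespace `Literature.NumberTheory.ModularForms.PoincareWeightTwo`).
DEFINITIONS with bodies, plus the elementary facts about them that need no analysis; no named fact.
Vocabulary for the formalisation of Petersson's formula at weight `2` (Iwaniec–Kowalski, *Analytic
Number Theory*, §14.1–§14.2: Poincaré series `P_m(z) = Σ_{γ ∈ Γ_∞\Γ₀(N)} j_γ(z)^{−k} e(mγz)`,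
Lemma 14.2 (Fourier expansion), Lemma 14.3 (unfolding), Prop. 14.5; at `k = 2` the series does not
converge absolutely and is defined through Hecke's trick, `P_m(z) = lim_{s→0⁺} Σ j_γ(z)^{−2}|j_γ(z)|^{−2s} e(mγz)`;
Kowalski–Michel 2000, §2.4.2 p. 312, is the level-`q`, weight-`2` instance consumed by the tree).

## Main definitions

* `Row N` — the index set `{(c, d) ∈ ℤ² : (c, d) = 1, N ∣ c}` of `Γ_∞\Γ₀(N)` up to sign (the tree's
  indexation of `Gamma0RankinSelbergUnfolding.bijective_T_zpow_mul_rowSection`); `rowMatrix v` — an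
  EXPLICIT matrix of `SL(2, ℤ)` with bottom row `v` (top row from the extended Euclidean algorithm,
  `Int.gcdA/gcdB`), in `Γ₀(N)` when `N ∣ c` (`rowMatrix_mem_Gamma0`); `rowDenom v z = cz + d`.
* `poincareTerm N m s v z = (cz+d)⁻² |cz+d|^{−2s} e(m · rowMatrix v z)` and the **Hecke-regularised
  weight-2 Poincaré series** `poincareHecke N m s z = ½ Σ_{v ∈ Row N} poincareTerm N m s v z`
  (`½` because `±v` give the same term; absolutely convergent for `s > 0`, IK §14.1 with (3.13)).
* `poincareCoeff N m n = δ(m,n) − √(n/m) · J_N(m,n)` with `J_N(m,n) = petJ N m n =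
  (2π/N) Σ_{r≥1} r⁻¹ S(m,n;Nr) J₁(4π√(mn)/(Nr))` (Kowalski–Michel's `J`), i.e. the printed Fourier
  coefficient `p_m(n) = δ(m,n) + 2π i^{−k} (n/m)^{(k−1)/2} Σ_{c ≡ 0 (N)} c⁻¹ S(m,n;c) J_{k−1}(4π√(mn)/c)`
  of `P_m` at `k = 2` (IK Lemma 14.2), and the `q`-series `poincareQSeries N m z = Σ_{n≥1} p_m(n) e(nz)`.
* `modeIntegral s A B y = ∫_ℝ (t+iy)⁻² |t+iy|^{−2s} e(−A/(t+iy)) e(−Bt) dt` — the cell integral of the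
  Fourier expansion of `poincareHecke` (at `s = 0` it is `e^{−2πBy}·(−2π√(B/A) J₁(4π√(AB)))` by the
  tree's `weightTwo_besselModeIntegral`).
* `peterssonPairing N k g₁ g₂` — the Petersson pairing `∫_{Γ₀(N)\ℍ} conj(g₁) g₂ yᵏ dμ` of two FUNCTIONS
  on `ℍ` (same normalisation and body as the tree's `peterssonProduct` for cusp forms: integral over
  `ModularGroup.fd` of the sum over `SL(2,ℤ)/Γ₀(N)`; meaningful when `conj(g₁) g₂ yᵏ` is
  `Γ₀(N)`-invariant, e.g. both of weight `k`); `peterssonPairing_coe_eq` identifies it with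
  `peterssonProduct` on cusp forms.

## References

* [IwaniecKowalski2004] H. Iwaniec, E. Kowalski, *Analytic Number Theory*, AMS Colloq. Publ. 53,
  §14.1 (Poincaré series, (14.4)), §14.2 Lemma 14.2, Lemma 14.3, Prop. 14.5; §3.2 (Hecke's trick).
* [KowalskiMichel2000] E. Kowalski, P. Michel, Acta Arith. 94 (2000), §2.4.2 p. 312 (`J(l₁,l₂)`).
* [Iwaniec2002] H. Iwaniec, *Spectral Methods of Automorphic Forms*, §2.3, §3.1–§3.2 (rows of
  `Γ_∞\Γ`, Poincaré series, unfolding) — the weight-0 counterpart is the tree's `Fuchsian.poincare`.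
-/

noncomputable section

open scoped MatrixGroups Real
open CongruenceSubgroup Complex MeasureTheory
open UpperHalfPlane hiding I
open Literature.NumberTheory.EllipticCurves.ModularForms
open Literature.NumberTheory.LFunctions.KowalskiMichel2000 (petJ)

namespace Literature.NumberTheory.ModularForms.PoincareWeightTwo

/-! ### Rows `(c, d)` of `Γ_∞\Γ₀(N)` and an explicit matrix over each row -/

/-- The rows `(c, d)`, `(c, d) = 1`, `N ∣ c` — the index set of the Poincaré and Eisenstein series of
the cusp `∞` of `Γ₀(N)` up to the sign `±(c,d)` (Iwaniec–Kowalski §14.1; the tree's indexation in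
`bijective_T_zpow_mul_rowSection`). [cite: IwaniecKowalski2004, §14.1 (14.4)] -/
abbrev Row (N : ℕ) : Type := {v : Fin 2 → ℤ // IsCoprime (v 0) (v 1) ∧ (N : ℤ) ∣ v 0}

/-- An explicit matrix `(a b; c d) ∈ SL(2, ℤ)` with prescribed coprime bottom row `(c, d)`: the top
row is `(gcdA d c, −gcdB d c)` from the extended Euclidean algorithm, `d·gcdA + c·gcdB = 1`.
[cite: IwaniecKowalski2004, §14.1 (14.4)] -/
def rowMatrix (v : Fin 2 → ℤ) (hv : IsCoprime (v 0) (v 1)) : SL(2, ℤ) :=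
  ⟨!![Int.gcdA (v 1) (v 0), -Int.gcdB (v 1) (v 0); v 0, v 1], by
    have h1 : Int.gcd (v 1) (v 0) = 1 := Int.isCoprime_iff_gcd_eq_one.mp hv.symm
    have h2 := Int.gcd_eq_gcd_ab (v 1) (v 0)
    rw [h1] at h2
    rw [Matrix.det_fin_two_of]
    push_cast at h2
    linear_combination -h2⟩

/-- The bottom-left entry of `rowMatrix v` is `c = v 0`. [cite: IwaniecKowalski2004, §14.1 (14.4)] -/
@[simp] theorem rowMatrix_apply_one_zero (v : Fin 2 → ℤ) (hv : IsCoprime (v 0) (v 1)) :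
    (rowMatrix v hv) 1 0 = v 0 := rfl

/-- The bottom-right entry of `rowMatrix v` is `d = v 1`. [cite: IwaniecKowalski2004, §14.1 (14.4)] -/
@[simp] theorem rowMatrix_apply_one_one (v : Fin 2 → ℤ) (hv : IsCoprime (v 0) (v 1)) :
    (rowMatrix v hv) 1 1 = v 1 := rfl

/-- For `N ∣ c` the matrix `rowMatrix (c, d)` lies in `Γ₀(N)`. [cite: IwaniecKowalski2004, §14.1 (14.4)] -/
theorem rowMatrix_mem_Gamma0 {N : ℕ} (v : Row N) : rowMatrix v.1 v.2.1 ∈ Gamma0 N := by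
  rw [Gamma0_mem]
  change ((v.1 0 : ℤ) : ZMod N) = 0
  rw [ZMod.intCast_zmod_eq_zero_iff_dvd]
  exact v.2.2

/-- The automorphy factor `j_{(c,d)}(z) = cz + d` of a row. [cite: IwaniecKowalski2004, §14.1 (14.4)] -/
def rowDenom (v : Fin 2 → ℤ) (z : ℍ) : ℂ := (v 0 : ℂ) * (z : ℂ) + v 1

/-- `cz + d ≠ 0` for a coprime row (`(c, d) ≠ (0, 0)` and `Im z > 0`). [cite: IwaniecKowalski2004, §14.1 (14.4)] -/
theorem rowDenom_ne_zero (v : Fin 2 → ℤ) (hv : IsCoprime (v 0) (v 1)) (z : ℍ) : rowDenom v z ≠ 0 := by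
  intro h
  have him := congrArg Complex.im h
  have hre := congrArg Complex.re h
  simp only [rowDenom, add_im, mul_im, intCast_re, intCast_im, zero_mul, add_zero, zero_im,
    UpperHalfPlane.coe_im, add_re, mul_re, sub_zero, UpperHalfPlane.coe_re, zero_re] at him hre
  have hc : (v 0 : ℝ) = 0 := by
    rcases mul_eq_zero.mp him with h0 | h0
    · exact h0
    · exact absurd h0 z.im_pos.ne'
  rw [hc, zero_mul, zero_add] at hre
  have hc' : v 0 = 0 := by exact_mod_cast hc
  have hd' : v 1 = 0 := by exact_mod_cast hre
  have h := hv
  rw [hc', hd'] at h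
  exact not_isCoprime_zero_zero h

/-! ### The Hecke-regularised weight-2 Poincaré series -/

/-- One term of the weight-2 Poincaré series with Hecke's convergence factor:
`(cz+d)⁻² |cz+d|^{−2s} e(m · γ_{(c,d)} z)` (Iwaniec–Kowalski §14.1 (14.4) at `k = 2`, times
`|j_γ(z)|^{−2s}` as in Hecke's trick, §3.2). [cite: IwaniecKowalski2004, §14.1 (14.4)] -/
def poincareTerm (N m : ℕ) (s : ℝ) (v : Row N) (z : ℍ) : ℂ :=
  ((rowDenom v.1 z) ^ 2)⁻¹ * ((‖rowDenom v.1 z‖ ^ (-(2 * s)) : ℝ) : ℂ) *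
    cexp (2 * π * I * m * ((rowMatrix v.1 v.2.1 • z : ℍ) : ℂ))

/-- **The Hecke-regularised weight-2 Poincaré series of level `Γ₀(N)`**,
`P_m(z, s) = Σ_{γ ∈ Γ_∞\Γ₀(N)} j_γ(z)⁻² |j_γ(z)|^{−2s} e(mγz) = ½ Σ_{(c,d)=1, N∣c} (cz+d)⁻² |cz+d|^{−2s} e(mγ_{(c,d)}z)`
(each coset `Γ_∞γ`, `−1 ∈ Γ_∞`, is counted by the two rows `±(c, d)`); absolutely convergent for
`s > 0`; `P_m = lim_{s→0⁺} P_m(·, s)` is the weight-2 Poincaré series (Iwaniec–Kowalski §14.1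
(14.4), §3.2). The `tsum` is `0` by convention where the series diverges (`s ≤ 0`).
[cite: IwaniecKowalski2004, §14.1 (14.4)] -/
def poincareHecke (N m : ℕ) (s : ℝ) (z : ℍ) : ℂ :=
  (1 / 2 : ℂ) * ∑' v : Row N, poincareTerm N m s v z

/-- **The printed Fourier coefficient of the weight-2 Poincaré series** (Iwaniec–Kowalski Lemma 14.2
at `k = 2`): `p_m(n) = δ(m,n) + 2π i^{−2} (n/m)^{1/2} Σ_{c ≡ 0 (N)} c⁻¹ S(m,n;c) J₁(4π√(mn)/c)
= δ(m,n) − √n/√m · J_N(m,n)` with Kowalski–Michel's `J_N(m,n) = petJ N m n`.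
[cite: IwaniecKowalski2004, Lemma 14.2] [cite: KowalskiMichel2000, §2.4.2 p. 312 (J(l₁,l₂))] -/
def poincareCoeff (N : ℕ) [NeZero N] (m n : ℕ) : ℂ :=
  (if m = n then 1 else 0) - ((Real.sqrt n / Real.sqrt m : ℝ) : ℂ) * petJ N m n

/-- The `q`-series `Σ_{n ≥ 1} p_m(n) e(nz)` with the printed coefficients of the weight-2 Poincaré
series (its identification with `lim_{s→0⁺} poincareHecke` is Hecke's theorem, not asserted here).
[cite: IwaniecKowalski2004, Lemma 14.2] -/
def poincareQSeries (N : ℕ) [NeZero N] (m : ℕ) (z : ℍ) : ℂ :=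
  ∑' n : ℕ, if n = 0 then 0 else poincareCoeff N m n * cexp (2 * π * I * n * (z : ℂ))

/-- **The cell integral** of the Fourier expansion of `poincareHecke` along the horocycle `Im z = y`:
`I_s(A, B; y) = ∫_ℝ (t+iy)⁻² |t+iy|^{−2s} e(−A/(t+iy)) e(−Bt) dt` (after Poisson summation in
`d (mod c)` the `c`-cell contributes `c^{−2−2s} S(m,n;c) I_s(m/c², n; y)`; Iwaniec–Kowalski §14.2,
proof of Lemma 14.2). At `s = 0`, `B > 0` it equals `e^{−2πBy}·(−2π√(B/A) J₁(4π√(AB)))`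
(the tree's `weightTwo_besselModeIntegral`). [cite: IwaniecKowalski2004, §14.2 (proof of Lemma 14.2)] -/
def modeIntegral (s A B y : ℝ) : ℂ :=
  ∫ t : ℝ, (((t : ℂ) + y * I) ^ 2)⁻¹ * ((‖(t : ℂ) + y * I‖ ^ (-(2 * s)) : ℝ) : ℂ) *
    cexp (2 * π * I * (-(A : ℂ) / ((t : ℂ) + y * I) - B * t))

/-! ### The Petersson pairing of two functions on `Γ₀(N)\ℍ` -/

/-- **The Petersson pairing of two functions** `g₁, g₂ : ℍ → ℂ` at level `Γ₀(N)` and weight `k`: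
`∫_{Γ₀(N)\ℍ} conj(g₁) g₂ yᵏ dμ`, realised exactly as the tree's `peterssonProduct` (integral over the
standard fundamental domain `ModularGroup.fd` of the sum over the cosets `SL(2,ℤ)/Γ₀(N)` of
Mathlib's `UpperHalfPlane.petersson k g₁ g₂`, no volume normalisation; Iwaniec–Kowalski (14.11)).
Intended for pairs with `conj(g₁) g₂ yᵏ` invariant under `Γ₀(N)` (then the choice of coset
representatives is immaterial). [cite: IwaniecKowalski2004, (14.11)] -/
def peterssonPairing (N : ℕ) [NeZero N] (k : ℤ) (g₁ g₂ : ℍ → ℂ) : ℂ :=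
  letI := Fintype.ofFinite (𝒮ℒ ⧸ (Gamma0 N : Subgroup (GL (Fin 2) ℝ)).subgroupOf 𝒮ℒ)
  ∫ τ in ModularGroup.fd, ∑ q : 𝒮ℒ ⧸ (Gamma0 N : Subgroup (GL (Fin 2) ℝ)).subgroupOf 𝒮ℒ,
    petersson k g₁ g₂ (((q.out : 𝒮ℒ) : GL (Fin 2) ℝ)⁻¹ • τ)

/-- Square-integrability of a function of weight `k` on `Γ₀(N)\ℍ` in the normalisation of
`peterssonPairing`: `Σ_{q ∈ SL(2,ℤ)/Γ₀(N)} |g(q⁻¹τ)|² (Im q⁻¹τ)ᵏ` is integrable on the standard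
fundamental domain. [cite: IwaniecKowalski2004, (14.11)] -/
def PeterssonSqIntegrable (N : ℕ) [NeZero N] (k : ℤ) (g : ℍ → ℂ) : Prop :=
  letI := Fintype.ofFinite (𝒮ℒ ⧸ (Gamma0 N : Subgroup (GL (Fin 2) ℝ)).subgroupOf 𝒮ℒ)
  IntegrableOn (fun τ : ℍ ↦ ∑ q : 𝒮ℒ ⧸ (Gamma0 N : Subgroup (GL (Fin 2) ℝ)).subgroupOf 𝒮ℒ,
    ‖g (((q.out : 𝒮ℒ) : GL (Fin 2) ℝ)⁻¹ • τ)‖ ^ 2 *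
      ((((q.out : 𝒮ℒ) : GL (Fin 2) ℝ)⁻¹ • τ).im) ^ k) ModularGroup.fd volume

/-- On cusp forms the pairing of functions IS the tree's Petersson product:
`peterssonPairing N k ⇑f ⇑g = peterssonProduct (Γ₀(N)) k f g` (the integrand is `Γ₀(N)`-invariant,
so the coset representative does not matter). [cite: IwaniecKowalski2004, (14.11)] -/
theorem peterssonPairing_coe_eq (N : ℕ) [NeZero N] (k : ℤ) (f g : CuspForm (Gamma0 N) k) :
    peterssonPairing N k ⇑f ⇑g = peterssonProduct (Gamma0 N) k f g := by
  unfold peterssonPairing peterssonProduct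
  congr 1
  funext τ
  refine Finset.sum_congr rfl fun q _ ↦ ?_
  induction q using QuotientGroup.induction_on with
  | H a =>
    obtain ⟨h, hh⟩ :=
      QuotientGroup.mk_out_eq_mul ((Gamma0 N : Subgroup (GL (Fin 2) ℝ)).subgroupOf 𝒮ℒ) a
    rw [hh]
    change petersson k ⇑f ⇑g (((a * h : 𝒮ℒ) : GL (Fin 2) ℝ)⁻¹ • τ) =
      petersson k ⇑f ⇑g ((a : GL (Fin 2) ℝ)⁻¹ • τ)
    have hmem : ((h : 𝒮ℒ) : GL (Fin 2) ℝ) ∈ (Gamma0 N : Subgroup (GL (Fin 2) ℝ)) := by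
      have := h.2
      rw [Subgroup.mem_subgroupOf] at this
      exact this
    rw [Subgroup.coe_mul, mul_inv_rev, mul_smul, SlashInvariantFormClass.petersson_smul (inv_mem hmem)]

end Literature.NumberTheory.ModularForms.PoincareWeightTwo

end
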